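import Literature.Computability.Complexity.TM2Iterate
import Mathlib.Algebra.BigOperators.Group.Finset.Basic
import HarnessLib

/-!
# Unclocked iteration of a machine until a stop symbol appears (pointwise `while` loop on `TM2`)

Toolkit for `TimeBounds.lean` (per-input time bounds), a sibling of `TM2Iterate.lean` (CLOCKED
iteration: the number of rounds is part of the input) and a documented GENERALISATION of
`LoopUntilFlag.lean` (`TM2Until.untilTM` / `TM2Until.untilAux_outputsWithin`: a machine over
`{0,1}` is run on its own output, with round tags, until the output raises the flag `1`, the
running time being the sum over the rounds executed). Both serve loops whose number of rounds is
not computable from the input; the present file exists because the closure of `SE` under SERF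
reductions (`Literature/Computability/Cryptography/SubexponentialProofs.lean`:
`SerfClosure.exists_decider`, `mem_SE_of_serfReducible_holds`; Impagliazzo–Paturi–Zane 2001,
§2.1) cannot be built on `TM2Until`, for two reasons:

1. **Pointwise hypothesis.** `TM2Until.untilAux_outputsWithin` asks for a TOTAL string function
   `F` with `∀ u, Mx.OutputsWithin u (F u) (T u)`. The loop body of the SE closure embeds the
   black-box step machine `N` of a SERF reduction (`SERFReducible`, clause 2), which is specified
   — halting included — only on well-formed transcripts `boolPair x (listBool as)`; no total `F`
   exists for it. Here the hypothesis (`whileAux_outputsWithin`) concerns only the words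
   `w 0, …, w (n+1)` of the orbit actually traversed.
2. **Alphabet.** `TM2Until` is over `{0,1}` (auxiliary stacks, register and round tags are
   `Bool`). The SE-closure body runs `N` and the decider of `Q₂` inside the context machine
   `TM2Ctx.ctxAux` (`TM2Context.lean`), whose words live over `Option Bool` with `none` as field
   terminator; the loop therefore runs over `A = Option Bool` with stop symbol `none`.

Precise delta with `TM2Until` (recorded so that the two loop machines are not confused):
general alphabet `A` with a stop PREDICATE `stop : A → Bool` (there: `Bool`, flag = first bit
`1`); no round tag, the input is fed verbatim as round `0` and every output verbatim as the next
input (there: `0x`, then `1s`; an initialisation is composed in front with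
`TM2ComputableAux.comp` instead); the output KEEPS the stop symbol (there: the flag is removed);
hypotheses pointwise along an explicit orbit `w : ℕ → List A` (there: a total `F`). No new
bookkeeping is introduced: stacks, register, statement translation and configurations are those
of `TM2Iterate.lean` (`TM2Iter.IterΓ`, `St`, `mkStk`, `trStmt`, `cfgM`, `cfg`,
`stepAux_trStmt`), and the control statements `mv1`, `mv2`, `fin` ARE `TM2Iter.ctrlStmt`; only
the statement `test` is new. (`LoopUntilFlag.lean` carries its own `{0,1}`-typed copies
`TM2Until.LoopΓ/St/mkStk/trStmt/ctrlStmt`, which cannot be instantiated at another alphabet.)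

* `TM2While.whileTM M eIn eOut stop` — for a bundled `M : Turing.FinTM2` whose input and output
  alphabets are identified with `A`: run `M` on the input, look at the first symbol `a` of the
  output, halt with that output if `stop a` (or if the output is empty), otherwise feed the output
  back as the next input;
* `TM2While.whileAux_outputsWithin` — **main result**: if `Mx : TM2ComputableAux A A` maps the
  word `w i` to `w (i + 1)` within `m i` steps for all `i ≤ n`, the words `w 1, …, w n` start
  with a non-stop symbol and `w (n + 1)` starts with a stop symbol, then the loop machine maps
  `w 0` to `w (n + 1)` within `∑_{i ≤ n} (m i + 2 |w (i + 1)| + 2)` steps.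

## The machine

Stacks `M.K ⊕ TM2Iter.Aux` (of the three auxiliary stacks only the transfer stack `TMP` is used;
the input stack is the input stack `inl k₀` of `M`, the output stack its output stack `inl k₁`),
labels `M.Λ ⊕ TM2Iter.Ctrl` (main label `inl M.main`; `init1`, `init2` are unreachable), states
`M.σ × Option (Option A)`. Control flow:

* `M` started in Mathlib's `initList` form halts in `haltList` form: at `test` the output sits on
  `k₁`, the other stacks are empty and the state is reset;
* `test` (`TM2While.ctrlStmt`): pop `k₁`; if it was empty, or if the popped symbol `a` satisfies
  `stop a` (then push it back), go to `fin`; otherwise put `a` on `TMP` and go to `mv1`;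
* `mv1`, `mv2`, `fin` (`TM2Iter.ctrlStmt`): pour the rest of `k₁` onto `TMP`, pour `TMP` onto
  `k₀` (the two reversals restore the order) and jump to `M.main`; `fin` resets the state and
  halts — Mathlib's `haltList` convention.

One continuing round costs `m + 2|y| + 2` steps (`m` steps of `M`, output `y`), the last round
`m + 2` steps (`round_go`, `round_stop`).

## References

* S. Arora, B. Barak, *Computational Complexity: A Modern Approach*, CUP 2009, §1.3 (machine
  constructions; the time of a loop is the sum over its iterations), §1.4.1 (run the simulated
  machine until it halts), §3.4 (oracle machines). doi:10.1017/cbo9780511804090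
* R. Impagliazzo, R. Paturi, F. Zane, *Which problems have strongly exponential complexity?*,
  J. Comput. System Sci. 63 (2001) 512–530, §2.1 (the consumer: SE is closed under SERF
  reductions).
* Mathlib, `Mathlib/Computability/TuringMachine/Computable.lean` (`FinTM2`, `initList`,
  `haltList`, `TM2OutputsInTime`).
-/

namespace Literature.Computability.Complexity

namespace TM2While

open Turing StateTransition Function TM2Comp TM2Iter

/-! ### The control statements -/

section Machine

variable {K : Type} {G : K → Type} {Λ σ A : Type}
variable [Inhabited A] (k₀ k₁ : K) (eIn : G k₀ ≃ A) (eOut : G k₁ ≃ A) (main : Λ) (init : σ)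
  (stop : A → Bool)

/-- The control statements of the `while` machine: the new statement `test` — pop the output
stack `k₁` of the iterated machine; empty output or a stop symbol (pushed back) ⟹ `fin`;
otherwise the symbol goes to `TMP` and on to `mv1` — and, for every other label, the control
statement of the clocked loop machine `TM2Iter.ctrlStmt` (`mv1`: pour `k₁` onto `TMP`; `mv2`:
pour `TMP` onto `k₀` and restart the iterated machine at `main`; `fin`: reset the state and
halt; `init1`/`init2`: unreachable here). Every control statement resets the symbol register
before jumping. [folklore] -/
def ctrlStmt : Ctrl → TM2.Stmt (IterΓ G A) (Λ ⊕ Ctrl) (St σ A)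
  | Ctrl.test =>
      TM2.Stmt.pop (Sum.inl k₁) (fun v a => (v.1, a.map fun g => some (eOut g))) <|
        TM2.Stmt.branch (fun v => v.2.isNone)
          (TM2.Stmt.load rst <| TM2.Stmt.goto fun _ => Sum.inr Ctrl.fin) <|
          TM2.Stmt.branch (fun v => stop (iget v.2))
            (TM2.Stmt.push (Sum.inl k₁) (fun v => eOut.symm (iget v.2)) <| TM2.Stmt.load rst <|
              TM2.Stmt.goto fun _ => Sum.inr Ctrl.fin)
            (TM2.Stmt.push (Sum.inr Aux.TMP) (fun v => iget v.2) <| TM2.Stmt.load rst <|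
              TM2.Stmt.goto fun _ => Sum.inr Ctrl.mv1)
  | c => TM2Iter.ctrlStmt k₀ k₁ eIn eOut main init c

end Machine

/-! ### Bundling: the `while` machine as a `FinTM2` -/

section Bundled

variable (M : FinTM2) {A : Type} [Inhabited A] (eIn : M.Γ M.k₀ ≃ A) (eOut : M.Γ M.k₁ ≃ A)
  (stop : A → Bool)

/-- The `while` machine of a bundled TM2 machine `M` whose input and output alphabets are
identified with `A`, with stop predicate `stop : A → Bool`: stacks `M.K ⊕ Aux` (input stack
`inl k₀`, output stack `inl k₁`), labels `M.Λ ⊕ Ctrl` (main label `inl M.main`), states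
`M.σ × Option (Option A)`. It runs `M` repeatedly, feeding each output back as the next input,
until an output is empty or starts with a stop symbol, and then halts with that output.
[cite: AroraBarak2009, §1.4.1 (run the simulated machine until it halts)] -/
noncomputable def whileTM : FinTM2 :=
  letI := M.kFin; letI := M.ΛFin; letI := M.σFin; letI := M.Γk₀Fin
  letI : Fintype A := Fintype.ofEquiv _ eIn
  { K := M.K ⊕ Aux
    k₀ := Sum.inl M.k₀
    k₁ := Sum.inl M.k₁
    Γ := IterΓ M.Γ A
    Λ := M.Λ ⊕ Ctrl
    main := Sum.inl M.main
    σ := St M.σ A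
    initialState := (M.initialState, none)
    Γk₀Fin := M.Γk₀Fin
    m := fun l => match l with
      | Sum.inl l => trStmt (M.m l)
      | Sum.inr c => ctrlStmt M.k₀ M.k₁ eIn eOut M.main M.initialState stop c }

/-- A step of the `while` machine at a control label, unbundled. [folklore] -/
theorem step_inr (c : Ctrl) (var : St M.σ A) (stk : ∀ j, List (IterΓ M.Γ A j)) :
    (whileTM M eIn eOut stop).step
        (⟨some (Sum.inr c), var, stk⟩ : TM2.Cfg (IterΓ M.Γ A) (M.Λ ⊕ Ctrl) (St M.σ A)) =
      some (TM2.stepAux (ctrlStmt M.k₀ M.k₁ eIn eOut M.main M.initialState stop c) var stk) :=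
  rfl

/-- A step of the `while` machine at a label of the iterated machine, unbundled. [folklore] -/
theorem step_inl (l : M.Λ) (var : St M.σ A) (stk : ∀ j, List (IterΓ M.Γ A j)) :
    (whileTM M eIn eOut stop).step
        (⟨some (Sum.inl l), var, stk⟩ : TM2.Cfg (IterΓ M.Γ A) (M.Λ ⊕ Ctrl) (St M.σ A)) =
      some (TM2.stepAux (trStmt (M.m l)) var stk) :=
  rfl

/-! ### Single steps of the control labels -/

section Steps

variable (v : M.σ) (S : ∀ k, List (M.Γ k)) (t : List A)

/-- `test` on an empty output: proceed to `fin`. [folklore] -/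
theorem step_test_nil :
    (whileTM M eIn eOut stop).step
        (cfg M A (some (Sum.inr Ctrl.test)) v (update S M.k₁ []) [] t []) =
      some (cfg M A (some (Sum.inr Ctrl.fin)) v (update S M.k₁ []) [] t []) := by
  rw [cfg, step_inr]; simp [ctrlStmt, rst, cfg]

/-- `test` on an output starting with a stop symbol: leave the output in place and proceed to
`fin`. [folklore] -/
theorem step_test_stop (g : M.Γ M.k₁) (L : List (M.Γ M.k₁)) (hg : stop (eOut g) = true) :
    (whileTM M eIn eOut stop).step
        (cfg M A (some (Sum.inr Ctrl.test)) v (update S M.k₁ (g :: L)) [] t []) =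
      some (cfg M A (some (Sum.inr Ctrl.fin)) v (update S M.k₁ (g :: L)) [] t []) := by
  rw [cfg, step_inr]; simp [ctrlStmt, rst, iget, cfg, hg]

/-- `test` on an output starting with a non-stop symbol: move it to `TMP` and proceed to `mv1`.
[folklore] -/
theorem step_test_go (g : M.Γ M.k₁) (L : List (M.Γ M.k₁)) (hg : stop (eOut g) = false) :
    (whileTM M eIn eOut stop).step
        (cfg M A (some (Sum.inr Ctrl.test)) v (update S M.k₁ (g :: L)) [] t []) =
      some (cfg M A (some (Sum.inr Ctrl.mv1)) v (update S M.k₁ L) [] (eOut g :: t) []) := by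
  rw [cfg, step_inr]; simp [ctrlStmt, rst, iget, cfg, hg]

/-- `mv1` on nonempty `k₁`: move one symbol to `TMP` (through `eOut`). [folklore] -/
theorem step_mv1_cons (g : M.Γ M.k₁) (L : List (M.Γ M.k₁)) :
    (whileTM M eIn eOut stop).step
        (cfg M A (some (Sum.inr Ctrl.mv1)) v (update S M.k₁ (g :: L)) [] t []) =
      some (cfg M A (some (Sum.inr Ctrl.mv1)) v (update S M.k₁ L) [] (eOut g :: t) []) := by
  rw [cfg, step_inr]; simp [ctrlStmt, TM2Iter.ctrlStmt, rst, iget, cfg]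

/-- `mv1` on empty `k₁`: proceed to `mv2`. [folklore] -/
theorem step_mv1_nil :
    (whileTM M eIn eOut stop).step
        (cfg M A (some (Sum.inr Ctrl.mv1)) v (update S M.k₁ []) [] t []) =
      some (cfg M A (some (Sum.inr Ctrl.mv2)) v (update S M.k₁ []) [] t []) := by
  rw [cfg, step_inr]; simp [ctrlStmt, TM2Iter.ctrlStmt, rst, cfg]

/-- `mv2` on nonempty `TMP`: move one symbol to `k₀` (through `eIn.symm`). [folklore] -/
theorem step_mv2_cons (s : A) :
    (whileTM M eIn eOut stop).step (cfg M A (some (Sum.inr Ctrl.mv2)) v S [] (s :: t) []) =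
      some (cfg M A (some (Sum.inr Ctrl.mv2)) v
        (update S M.k₀ (eIn.symm s :: S M.k₀)) [] t []) := by
  rw [cfg, step_inr]; simp [ctrlStmt, TM2Iter.ctrlStmt, rst, iget, cfg]

/-- `mv2` on empty `TMP`: jump to the main label of `M`. [folklore] -/
theorem step_mv2_nil :
    (whileTM M eIn eOut stop).step (cfg M A (some (Sum.inr Ctrl.mv2)) v S [] [] []) =
      some (cfg M A (some (Sum.inl M.main)) v S [] [] []) := by
  rw [cfg, step_inr]; simp [ctrlStmt, TM2Iter.ctrlStmt, rst, cfg]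

/-- `fin`: reset the state and halt. [folklore] -/
theorem step_fin (i : List (Option A)) (c : List Unit) :
    (whileTM M eIn eOut stop).step (cfg M A (some (Sum.inr Ctrl.fin)) v S i t c) =
      some (cfg M A none M.initialState S i t c) := by
  rw [cfg, step_inr]; simp [ctrlStmt, TM2Iter.ctrlStmt, cfg]

/-- A step of the iterated machine `M` is a step of the `while` machine on the embedded
configuration. [folklore] -/
theorem step_cfgM (a b : M.Cfg) (h : M.step a = some b) (cnt : List Unit) :
    (whileTM M eIn eOut stop).step (cfgM (A := A) a cnt) = some (cfgM b cnt) := by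
  obtain ⟨_ | l, w, S'⟩ := a
  · simp [FinTM2.step, TM2.step] at h
  · simp only [FinTM2.step, TM2.step] at h
    obtain rfl := Option.some.inj h
    simp only [cfgM, Option.elim]
    rw [step_inl, stepAux_trStmt]
    rfl

end Steps

/-! ### Phases and rounds -/

section Phases

variable (v : M.σ) (S : ∀ k, List (M.Γ k))

/-- `mv1`: the output stack `k₁` of `M` is moved (reversed, read through `eOut`) onto `TMP`,
then the machine proceeds to `mv2`. [folklore] -/
theorem mv1_run (L : List (M.Γ M.k₁)) (t : List A) :
    ReachesIn (C := LCfg M A) (whileTM M eIn eOut stop).step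
      (cfg M A (some (Sum.inr Ctrl.mv1)) v (update S M.k₁ L) [] t [])
      (cfg M A (some (Sum.inr Ctrl.mv2)) v (update S M.k₁ []) [] (L.reverse.map eOut ++ t) [])
      (L.length + 1) := by
  induction L generalizing t with
  | nil => simpa using ReachesIn.single (step_mv1_nil M eIn eOut stop v S t)
  | cons g L ih =>
    simpa [List.append_assoc] using
      ReachesIn.step_trans (step_mv1_cons M eIn eOut stop v S t g L) (ih (eOut g :: t))

/-- `mv2`: `TMP` is moved (reversed, written through `eIn`) on top of the input stack `k₀` of
`M`, then the machine jumps to the main label of `M`. [folklore] -/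
theorem mv2_run (t : List A) :
    ReachesIn (C := LCfg M A) (whileTM M eIn eOut stop).step
      (cfg M A (some (Sum.inr Ctrl.mv2)) v S [] t [])
      (cfg M A (some (Sum.inl M.main)) v (update S M.k₀ (t.reverse.map eIn.symm ++ S M.k₀))
        [] [] [])
      (t.length + 1) := by
  induction t generalizing S with
  | nil =>
    simpa using ReachesIn.single (step_mv2_nil M eIn eOut stop v S)
  | cons s t ih =>
    have := ih (update S M.k₀ (eIn.symm s :: S M.k₀))
    rw [update_idem, update_self] at this
    simpa [List.append_assoc] using
      ReachesIn.step_trans (step_mv2_cons M eIn eOut stop v S t s) this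

/-- A run of the iterated machine `M` is a run of the `while` machine on embedded
configurations. [folklore] -/
theorem run_cfgM {n : ℕ} {a b : M.Cfg} (h : (flip bind M.step)^[n] (some a) = some b)
    (cnt : List Unit) :
    (flip bind (whileTM M eIn eOut stop).step)^[n] (some (cfgM (A := A) a cnt)) =
      some (cfgM b cnt) :=
  iterate_bind_map M.step (whileTM M eIn eOut stop).step (fun x => cfgM x cnt)
    (fun x y hxy => step_cfgM M eIn eOut stop x y hxy cnt) n a b h

/-- The initial configuration of the `while` machine on input `l` is the embedded initial
configuration of `M` on `l`. [folklore] -/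
theorem initList_whileTM (l : List (M.Γ M.k₀)) :
    initList (whileTM M eIn eOut stop) l = cfgM (A := A) (initList M l) [] := by
  rw [initList_eq, cfgM_initList]
  change (⟨some (Sum.inl M.main), (M.initialState, none),
      update (fun j => ([] : List (IterΓ M.Γ A j))) (Sum.inl M.k₀) l⟩ :
      TM2.Cfg (IterΓ M.Γ A) (M.Λ ⊕ Ctrl) (St M.σ A)) = _
  rw [← mkStk_bot_inl]
  rfl

/-- The halting configuration of the `while` machine. [folklore] -/
theorem haltList_whileTM (L : List (M.Γ M.k₁)) :
    haltList (whileTM M eIn eOut stop) L =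
      cfg M A none M.initialState (update (fun _ => []) M.k₁ L) [] [] [] := by
  rw [haltList_eq]
  change (⟨none, (M.initialState, none),
      update (fun j => ([] : List (IterΓ M.Γ A j))) (Sum.inl M.k₁) L⟩ :
      TM2.Cfg (IterΓ M.Γ A) (M.Λ ⊕ Ctrl) (St M.σ A)) = _
  rw [← mkStk_bot_inl]
  rfl

/-- **A continuing round.** If `M` maps `x` to `y = a :: rest` within `m` steps (from `initList`
to `haltList`) and `a` is not a stop symbol, then from the initial configuration of `M` on `x`
the `while` machine reaches the initial configuration of `M` on `y` within `m + 2|y| + 2` steps.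
[folklore] -/
theorem round_go {x y : List A} {m : ℕ} {a : A} {rest : List A} (hy : y = a :: rest)
    (ha : stop a = false)
    (h : ReachesIn M.step (initList M (x.map eIn.symm)) (haltList M (y.map eOut.symm)) m) :
    ReachesIn (C := LCfg M A) (whileTM M eIn eOut stop).step
      (cfgM (A := A) (initList M (x.map eIn.symm)) [])
      (cfgM (A := A) (initList M (y.map eIn.symm)) []) (m + 2 * y.length + 2) := by
  obtain ⟨k, hk, e⟩ := h
  subst hy
  -- run `M`
  have h1 : ReachesIn (C := LCfg M A) (whileTM M eIn eOut stop).step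
      (cfgM (A := A) (initList M (x.map eIn.symm)) [])
      (cfgM (haltList M ((a :: rest).map eOut.symm)) []) m :=
    ⟨k, hk, run_cfgM M eIn eOut stop e _⟩
  rw [cfgM_haltList, List.map_cons] at h1
  -- test: the first output symbol goes to `TMP`
  have h2 := ReachesIn.single (step_test_go M eIn eOut stop M.initialState (fun _ => [])
    [] (eOut.symm a) (rest.map eOut.symm) (by simpa using ha))
  rw [Equiv.apply_symm_apply] at h2
  -- mv1: the rest of `k₁` to `TMP`
  have h3 := mv1_run M eIn eOut stop M.initialState (fun _ => []) (rest.map eOut.symm) [a]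
  have hr : (rest.map eOut.symm).reverse.map eOut ++ [a] = (a :: rest).reverse := by
    simp [List.map_reverse]
  rw [hr, List.length_map, update_eq_self] at h3
  -- mv2: `TMP` to `k₀`
  have h4 := mv2_run M eIn eOut stop M.initialState (fun _ => []) (a :: rest).reverse
  rw [List.reverse_reverse, List.append_nil, List.length_reverse, ← cfgM_initList] at h4
  have := ((h1.trans h2).trans h3).trans h4
  refine this.mono ?_
  simp only [List.length_cons]
  omega

/-- **The last round.** If `M` maps `x` to `y = a :: rest` within `m` steps and `a` is a stop
symbol, then from the initial configuration of `M` on `x` the `while` machine halts with output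
`y` within `m + 2` steps. [folklore] -/
theorem round_stop {x y : List A} {m : ℕ} {a : A} {rest : List A} (hy : y = a :: rest)
    (ha : stop a = true)
    (h : ReachesIn M.step (initList M (x.map eIn.symm)) (haltList M (y.map eOut.symm)) m) :
    ReachesIn (C := LCfg M A) (whileTM M eIn eOut stop).step
      (cfgM (A := A) (initList M (x.map eIn.symm)) [])
      (haltList (whileTM M eIn eOut stop) (y.map eOut.symm)) (m + 2) := by
  obtain ⟨k, hk, e⟩ := h
  subst hy
  have h1 : ReachesIn (C := LCfg M A) (whileTM M eIn eOut stop).step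
      (cfgM (A := A) (initList M (x.map eIn.symm)) [])
      (cfgM (haltList M ((a :: rest).map eOut.symm)) []) m :=
    ⟨k, hk, run_cfgM M eIn eOut stop e _⟩
  rw [cfgM_haltList, List.map_cons] at h1
  have h2 := ReachesIn.single (step_test_stop M eIn eOut stop M.initialState (fun _ => [])
    [] (eOut.symm a) (rest.map eOut.symm) (by simpa using ha))
  have h3 := ReachesIn.single (step_fin M eIn eOut stop M.initialState
    (update (fun _ => []) M.k₁ (eOut.symm a :: rest.map eOut.symm)) [] [] [])
  rw [haltList_whileTM, List.map_cons]
  exact ((h1.trans h2).trans h3).mono le_rfl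

end Phases

end Bundled

/-! ### The `while` machine runs the orbit to its first stop -/

section Main

variable {A : Type} [Inhabited A] (Mx : TM2ComputableAux A A) (stop : A → Bool)

/-- The `while` machine of `Mx : TM2ComputableAux A A` with stop predicate `stop`, as a machine
with input and output alphabet `A`. [folklore] -/
noncomputable def whileAux : TM2ComputableAux A A :=
  ⟨whileTM Mx.tm Mx.inputAlphabet Mx.outputAlphabet stop, Mx.inputAlphabet, Mx.outputAlphabet⟩

/-- **Correctness and running time of the `while` machine.** Let `w 0, w 1, …, w (n + 1)` be
words such that `Mx` maps `w i` to `w (i + 1)` within `m i` steps (`i ≤ n`), the intermediate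
words `w (i + 1)`, `i < n`, start with a symbol that is not a stop symbol, and `w (n + 1)`
starts with a stop symbol. Then on input `w 0` the `while` machine halts with output `w (n + 1)`
within `∑_{i ≤ n} (m i + 2 |w (i + 1)| + 2)` steps.
[cite: AroraBarak2009, §1.4.1 (run the simulated machine until it halts)] -/
theorem whileAux_outputsWithin (n : ℕ) (w : ℕ → List A) (m : ℕ → ℕ)
    (hrun : ∀ i ≤ n, Mx.OutputsWithin (w i) (w (i + 1)) (m i))
    (hgo : ∀ i < n, ∃ a rest, w (i + 1) = a :: rest ∧ stop a = false)
    (hstop : ∃ a rest, w (n + 1) = a :: rest ∧ stop a = true) :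
    (whileAux Mx stop).OutputsWithin (w 0) (w (n + 1))
      (∑ i ∈ Finset.range (n + 1), (m i + 2 * (w (i + 1)).length + 2)) := by
  apply outputsWithin_of_reachesIn
  change ReachesIn (C := LCfg Mx.tm A)
    (whileTM Mx.tm Mx.inputAlphabet Mx.outputAlphabet stop).step
    (initList (whileTM Mx.tm Mx.inputAlphabet Mx.outputAlphabet stop)
      ((w 0).map Mx.inputAlphabet.symm))
    (haltList (whileTM Mx.tm Mx.inputAlphabet Mx.outputAlphabet stop)
      ((w (n + 1)).map Mx.outputAlphabet.symm)) _
  rw [initList_whileTM]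
  induction n generalizing w m with
  | zero =>
    obtain ⟨a, rest, hw, ha⟩ := hstop
    have h := round_stop Mx.tm Mx.inputAlphabet Mx.outputAlphabet stop hw ha
      (reachesIn_of_outputsWithin Mx (hrun 0 le_rfl))
    refine h.mono ?_
    simp
  | succ n ih =>
    obtain ⟨a, rest, hw, ha⟩ := hgo 0 (Nat.succ_pos n)
    have h1 := round_go Mx.tm Mx.inputAlphabet Mx.outputAlphabet stop hw ha
      (reachesIn_of_outputsWithin Mx (hrun 0 (Nat.zero_le _)))
    have h2 := ih (fun i => w (i + 1)) (fun i => m (i + 1))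
      (fun i hi => hrun (i + 1) (by omega))
      (fun i hi => hgo (i + 1) (by omega)) hstop
    refine (h1.trans h2).mono ?_
    rw [Finset.sum_range_succ' (fun i => m i + 2 * (w (i + 1)).length + 2)]
    omega

end Main

end TM2While

end Literature.Computability.Complexity
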